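import Summits.ABC.StewartYu.LatticeReducedRows
import Summits.ABC.StewartYu.SatFrameKit
import Mathlib.LinearAlgebra.Matrix.AbsoluteValue
import HarnessLib

/-!
# The REDUCED saturated basis (`SatBasisReduced`): re-basing `θ ↦ θ^P` so that `θᵢ^N = ∏ⱼ αⱼ^{Uᵢⱼ}` with `0 ≤ Uᵢⱼ ≤ N`

Support file (theorems only; no named facts). Cell `abc-stewartyu`, route `YuMatveevShapeRat` (A1.L), WP-L.P lattice kit
(R25 (3); plan ASSIGN / p2 16:22:59Z (A): the three SIZE lines of `SatKit`), seat p1. Input = the output of p3's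
`SatFrameKit.exists_satFrame` (or any saturated frame): `θ > 0`, `aⱼ = ∏ᵢ θᵢ^{C j i}`, `θᵢ^N = ∏ⱼ aⱼ^{U i j}`,
`C·U = N·1 = U·C`. Output (`exists_reduced_frame`): a new positive system `θ′ᵢ = ∏ₖ θₖ^{P i k}` with a unimodular
`P` (inverse `Q`), matrices `C′ = C·Q`, `U′ = P·U` satisfying the SAME relations, and **`0 ≤ U′ᵢⱼ ≤ N`** — so that
`h(θ′ᵢ) ≤ Σⱼ h(aⱼ)` (p2's `logHeight₁_prod_zpow_le_of_sat` with `E = 1`), `Σᵢ |U′ᵢⱼ| ≤ n·N`, and the transfer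
identities `∏ θ′^μ = ∏ θ^{μ ᵥ* P}`, `∏ θ^κ = ∏ θ′^{κ ᵥ* Q}` (independence and saturation of `θ` pass to `θ′`).
Mechanism: `LatticeRows.exists_reduced_rows` on the row lattice of `U` (which contains `N·ℤⁿ` since `C·U = N·1`).

## References
* [Cassels1997] J. W. S. Cassels, *An Introduction to the Geometry of Numbers*, Ch. I §2.2 (triangular bases).
* [Nesterenko2003] Yu. V. Nesterenko, LNM 1819 (2003) — §3.4–3.5 (the lattice `𝔑`, the basis of Cor 4.5).
-/

namespace Summit.ABC.StewartYu

namespace SatBasisReduced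

open Finset Matrix
open scoped Nat

variable {n : ℕ}

/-- the row `i` of a product: `(P * U) i = P i ᵥ* U`. [folklore] -/
theorem row_mul_eq_vecMul (P U : Matrix (Fin n) (Fin n) ℤ) (i : Fin n) : (P * U) i = P i ᵥ* U := by
  funext j; simp [Matrix.mul_apply, Matrix.vecMul, dotProduct]

/-- **Unimodular reduction of the virtual-coordinate matrix.** If `C·U = N·1` (`N ≥ 1`) then there are integer
matrices `P, Q` with `P·Q = 1 = Q·P` such that `0 ≤ (P·U) i j ≤ N` for all `i, j` (only `C·U` is used).
[cite: Cassels1997, Ch. I §2.2 Thm I] -/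
theorem exists_unimodular_reduce (N : ℕ) (hN : 0 < N) (C U : Matrix (Fin n) (Fin n) ℤ)
    (hCU : C * U = (N : ℤ) • (1 : Matrix (Fin n) (Fin n) ℤ)) :
    ∃ P Q : Matrix (Fin n) (Fin n) ℤ, P * Q = 1 ∧ Q * P = 1 ∧ ∀ i j, 0 ≤ (P * U) i j ∧ (P * U) i j ≤ N := by
  classical
  -- the row lattice of `U`
  set Λ : AddSubgroup (Fin n → ℤ) := (Matrix.vecMulLinear U).toAddMonoidHom.range with hΛ
  have hmemΛ : ∀ x, x ∈ Λ ↔ ∃ c : Fin n → ℤ, c ᵥ* U = x := fun x => by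
    simp [hΛ, AddMonoidHom.mem_range]
  -- `N·eⱼ = (row j of C) ᵥ* U ∈ Λ`
  have hsingle : ∀ j, Pi.single j (N : ℤ) ∈ Λ := by
    intro j
    refine (hmemΛ _).mpr ⟨C j, ?_⟩
    have h := row_mul_eq_vecMul C U j
    rw [hCU] at h
    rw [← h]; funext k
    simp [Matrix.smul_apply, Matrix.one_apply, Pi.single_apply, eq_comm]
  obtain ⟨H, hHmem, hHbox, -, -, hgen⟩ := LatticeRows.exists_reduced_rows Λ hN hsingle
  -- `H = P·U`
  choose p hp using fun i => (hmemΛ (H i)).mp (hHmem i)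
  -- `U = Q·H`
  choose q hq using fun k => hgen (U k) ((hmemΛ _).mpr ⟨Pi.single k 1, by funext j; simp [Matrix.vecMul, dotProduct, Pi.single_apply]⟩)
  set P : Matrix (Fin n) (Fin n) ℤ := Matrix.of p with hPdef
  set Q : Matrix (Fin n) (Fin n) ℤ := Matrix.of q with hQdef
  have hPU : P * U = H := by
    funext i; rw [row_mul_eq_vecMul]; exact hp i
  have hQH : Q * H = U := by
    funext k; rw [row_mul_eq_vecMul]; exact (hq k).symm
  -- `det U ≠ 0`
  have hdetU : U.det ≠ 0 := by
    intro h0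
    have h := congrArg Matrix.det hCU
    rw [Matrix.det_mul, h0, mul_zero, Matrix.det_smul, Matrix.det_one, mul_one, Fintype.card_fin] at h
    exact pow_ne_zero _ (by exact_mod_cast hN.ne') h.symm
  -- `(Q·P − 1)·U = 0 ⇒ Q·P = 1` (row by row, `det U ≠ 0` over the domain `ℤ`), then `P·Q = 1`
  have hQP : Q * P = 1 := by
    have h1 : (Q * P) * U = U := by rw [Matrix.mul_assoc, hPU, hQH]
    have h2 : (Q * P - 1) * U = 0 := by rw [Matrix.sub_mul, h1, Matrix.one_mul, sub_self]
    have h3 : Q * P - 1 = 0 := by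
      funext i
      have hrow : (Q * P - 1) i ᵥ* U = 0 := by
        rw [← row_mul_eq_vecMul, h2]; rfl
      exact Matrix.eq_zero_of_vecMul_eq_zero hdetU hrow
    exact sub_eq_zero.mp h3
  have hPQ : P * Q = 1 := mul_eq_one_comm.mp hQP
  refine ⟨P, Q, hPQ, hQP, fun i j => ?_⟩
  rw [hPU]; exact hHbox i j

/-- **THE REDUCED SATURATED FRAME.** From any saturated frame `θ > 0`, `aⱼ = ∏ᵢ θᵢ^{C j i}`, `θᵢ^N = ∏ⱼ aⱼ^{U i j}`,
`C·U = N·1 = U·C` (`aⱼ ≠ 0`, `N ≥ 1`) one gets `θ′ᵢ = ∏ₖ θₖ^{P i k}` (`P·Q = Q·P = 1`) with the same relations for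
`C′ = C·Q`, `U′ = P·U`, the entry bound `0 ≤ U′ᵢⱼ ≤ N`, and the transfer identities `∏ θ′^μ = ∏ θ^{μ ᵥ* P}`,
`∏ θ^κ = ∏ θ′^{κ ᵥ* Q}`. [cite: Nesterenko2003, §3.4–3.5 (the basis of 𝔑); Cassels1997, Ch. I §2.2] -/
theorem exists_reduced_frame (a θ : Fin n → ℚ) (ha : ∀ j, a j ≠ 0) (hθ : ∀ i, 0 < θ i)
    (C U : Matrix (Fin n) (Fin n) ℤ) (N : ℕ) (hN : 0 < N)
    (hC : ∀ j, a j = ∏ i, θ i ^ C j i) (hU : ∀ i, θ i ^ N = ∏ j, a j ^ U i j)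
    (hCU : C * U = (N : ℤ) • (1 : Matrix (Fin n) (Fin n) ℤ))
    (hUC : U * C = (N : ℤ) • (1 : Matrix (Fin n) (Fin n) ℤ)) :
    ∃ (θ' : Fin n → ℚ) (P Q : Matrix (Fin n) (Fin n) ℤ),
      P * Q = 1 ∧ Q * P = 1 ∧ (∀ i, 0 < θ' i) ∧
      (∀ μ : Fin n → ℤ, ∏ i, θ' i ^ μ i = ∏ k, θ k ^ (μ ᵥ* P) k) ∧
      (∀ κ : Fin n → ℤ, ∏ k, θ k ^ κ k = ∏ i, θ' i ^ (κ ᵥ* Q) i) ∧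
      (∀ j, a j = ∏ i, θ' i ^ (C * Q) j i) ∧
      (∀ i, θ' i ^ N = ∏ j, a j ^ (P * U) i j) ∧
      (C * Q) * (P * U) = (N : ℤ) • (1 : Matrix (Fin n) (Fin n) ℤ) ∧
      (P * U) * (C * Q) = (N : ℤ) • (1 : Matrix (Fin n) (Fin n) ℤ) ∧
      (∀ i j, 0 ≤ (P * U) i j ∧ (P * U) i j ≤ N) := by
  classical
  obtain ⟨P, Q, hPQ, hQP, hbox⟩ := exists_unimodular_reduce N hN C U hCU
  have hθ0 : ∀ i, θ i ≠ 0 := fun i => (hθ i).ne'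
  -- the new system
  set θ' : Fin n → ℚ := fun i => ∏ k, θ k ^ P i k with hθ'
  have hθ'def : ∀ i, θ' i = ∏ k, θ k ^ P i k := fun i => rfl
  have hθ'pos : ∀ i, 0 < θ' i := fun i => Finset.prod_pos fun k _ => zpow_pos (hθ k) _
  have hθ'0 : ∀ i, θ' i ≠ 0 := fun i => (hθ'pos i).ne'
  -- transfer identities
  have htr1 : ∀ μ : Fin n → ℤ, ∏ i, θ' i ^ μ i = ∏ k, θ k ^ (μ ᵥ* P) k := fun μ => by
    rw [KummerBasisChange.prod_zpow_basisChange θ hθ0 (fun i k => P i k) θ' hθ'def μ]; rfl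
  have htr2 : ∀ κ : Fin n → ℤ, ∏ k, θ k ^ κ k = ∏ i, θ' i ^ (κ ᵥ* Q) i := fun κ => by
    rw [htr1 (κ ᵥ* Q), Matrix.vecMul_vecMul, hQP, Matrix.vecMul_one]
  refine ⟨θ', P, Q, hPQ, hQP, hθ'pos, htr1, htr2, fun j => ?_, fun i => ?_, ?_, ?_, hbox⟩
  · -- `a j = θ^{C j} = θ'^{(C j) ᵥ* Q} = θ'^{(C Q) j}`
    rw [hC j, htr2 (C j), row_mul_eq_vecMul]
  · -- `θ'_i^N = ∏_k θ_k^{N P i k} = ∏_j a_j^{(P i ᵥ* U) j}`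
    have h1 : θ' i ^ N = ∏ k, (θ k ^ N) ^ P i k := by
      rw [hθ'def, ← Finset.prod_pow]
      refine Finset.prod_congr rfl fun k _ => ?_
      rw [← zpow_natCast, ← zpow_natCast, ← _root_.zpow_mul, ← _root_.zpow_mul, mul_comm]
    rw [h1, KummerBasisChange.prod_zpow_basisChange a ha (fun k j => U k j) (fun k => θ k ^ N) hU (P i),
      row_mul_eq_vecMul]
    rfl
  · rw [Matrix.mul_assoc, ← Matrix.mul_assoc Q P, hQP, Matrix.one_mul, hCU]
  · rw [Matrix.mul_assoc, ← Matrix.mul_assoc U C, hUC, Matrix.smul_mul, Matrix.one_mul, Matrix.mul_smul, hPQ]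

/-- **Column sums of the reduced `U′`**: `Σᵢ |U′ᵢⱼ| ≤ n·N`. [folklore] -/
theorem sum_abs_le_of_box {U' : Matrix (Fin n) (Fin n) ℤ} {N : ℕ} (h : ∀ i j, 0 ≤ U' i j ∧ U' i j ≤ N) (j : Fin n) :
    ∑ i, |U' i j| ≤ (n : ℤ) * N := by
  calc ∑ i, |U' i j| ≤ ∑ _i : Fin n, (N : ℤ) := Finset.sum_le_sum fun i _ => by
        rw [abs_of_nonneg (h i j).1]; exact (h i j).2
    _ = (n : ℤ) * N := by simp

/-! ### The matrix identities `U·C = N·1 = C·U` and the entry bound for `C` -/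

/-- **`U·C = N·1` from the two monomial relations and the independence of `θ`.** [folklore] -/
theorem mul_eq_smul_one_of_indep (a θ : Fin n → ℚ) (hθ0 : ∀ i, θ i ≠ 0)
    (hind : ∀ μ : Fin n → ℤ, ∏ i, θ i ^ μ i = 1 → μ = 0)
    (C U : Matrix (Fin n) (Fin n) ℤ) (N : ℕ)
    (hC : ∀ j, a j = ∏ i, θ i ^ C j i) (hU : ∀ i, θ i ^ N = ∏ j, a j ^ U i j) :
    U * C = (N : ℤ) • (1 : Matrix (Fin n) (Fin n) ℤ) := by
  classical
  funext i
  rw [row_mul_eq_vecMul]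
  have hsingle : θ i ^ N = ∏ k, θ k ^ (Pi.single i (N : ℤ) : Fin n → ℤ) k := by
    rw [Finset.prod_eq_single i (fun k _ hk => by rw [Pi.single_eq_of_ne hk, zpow_zero]) (by simp),
      Pi.single_eq_same, zpow_natCast]
  have h1 : ∏ k, θ k ^ ((U i ᵥ* C) k - (Pi.single i (N : ℤ) : Fin n → ℤ) k) = 1 := by
    simp_rw [zpow_sub₀ (hθ0 _)]
    rw [Finset.prod_div_distrib, SatCoords.prod_zpow_vecMul_eq a θ hθ0 C hC (U i), ← hU i, ← hsingle,
      div_self (pow_ne_zero _ (hθ0 i))]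
  have h2 := hind _ h1
  funext k
  have h3 := congrFun h2 k
  simp only [Pi.zero_apply, sub_eq_zero] at h3
  rw [h3]
  simp [Matrix.smul_apply, Matrix.one_apply, Pi.single_apply, eq_comm]

/-- **`C·U = N·1` from `U·C = N·1`** for square integer matrices (`N ≠ 0`). [folklore] -/
theorem mul_eq_smul_one_comm {N : ℤ} (hN : N ≠ 0) {C U : Matrix (Fin n) (Fin n) ℤ}
    (h : U * C = N • (1 : Matrix (Fin n) (Fin n) ℤ)) : C * U = N • (1 : Matrix (Fin n) (Fin n) ℤ) := by
  have hdetU : U.det ≠ 0 := by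
    intro h0
    have h1 := congrArg Matrix.det h
    rw [Matrix.det_mul, h0, zero_mul, Matrix.det_smul, Matrix.det_one, mul_one, Fintype.card_fin] at h1
    exact pow_ne_zero _ hN h1.symm
  have h2 : U * (C * U - N • (1 : Matrix (Fin n) (Fin n) ℤ)) = 0 := by
    rw [Matrix.mul_sub, ← Matrix.mul_assoc, h, Matrix.smul_mul, Matrix.one_mul, Matrix.mul_smul, Matrix.mul_one,
      sub_self]
  have h3 : C * U - N • (1 : Matrix (Fin n) (Fin n) ℤ) = 0 := by
    have hcol : ∀ k, (fun j => (C * U - N • (1 : Matrix (Fin n) (Fin n) ℤ)) j k) = 0 := fun k => by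
      refine Matrix.eq_zero_of_mulVec_eq_zero hdetU ?_
      funext i
      have := congrFun (congrFun h2 i) k
      simpa [Matrix.mul_apply, Matrix.mulVec, dotProduct] using this
    funext j k
    exact congrFun (hcol k) j
  exact sub_eq_zero.mp h3

/-- the adjugate of an integer matrix with entries in `[0, N]` (size `m+1`): `|adj U j k| ≤ m!·N^m`. [folklore] -/
theorem abs_adjugate_le {m : ℕ} (U : Matrix (Fin (m + 1)) (Fin (m + 1)) ℤ) {N : ℕ}
    (hbox : ∀ i j, 0 ≤ U i j ∧ U i j ≤ N) (j k : Fin (m + 1)) :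
    |U.adjugate j k| ≤ (m ! : ℤ) * (N : ℤ) ^ m := by
  rw [Matrix.adjugate_fin_succ_eq_det_submatrix, abs_mul, abs_pow, abs_neg, abs_one, one_pow, one_mul]
  have h := Matrix.det_le (abv := AbsoluteValue.abs) (A := U.submatrix k.succAbove j.succAbove) (x := (N : ℤ))
    (fun a b => by
      rw [AbsoluteValue.abs_apply, Matrix.submatrix_apply, abs_of_nonneg (hbox _ _).1]
      exact (hbox _ _).2)
  simpa [Fintype.card_fin, nsmul_eq_mul] using h

/-- **Entries of `C`**: `C·U = N·1`, `|det C| = N`, `0 ≤ Uᵢⱼ ≤ N` ⇒ `|C j k| ≤ (n−1)!·N` (Cramer: `det U·C = N·adj U`,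
`|det U| = N^{n−1}`, minors of `U` at most `(n−1)!·N^{n−1}`). [folklore] -/
theorem abs_le_of_mul_eq_smul_one {N : ℕ} (hN : 0 < N) (C U : Matrix (Fin n) (Fin n) ℤ)
    (hCU : C * U = (N : ℤ) • (1 : Matrix (Fin n) (Fin n) ℤ)) (hdet : |C.det| = N)
    (hbox : ∀ i j, 0 ≤ U i j ∧ U i j ≤ N) (j k : Fin n) :
    |C j k| ≤ ((n - 1) ! : ℤ) * N := by
  cases n with
  | zero => exact Fin.elim0 j
  | succ m =>
    have hNz : (N : ℤ) ≠ 0 := by exact_mod_cast hN.ne'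
    have hdd : C.det * U.det = (N : ℤ) ^ (m + 1) := by
      rw [← Matrix.det_mul, hCU, Matrix.det_smul, Matrix.det_one, mul_one, Fintype.card_fin]
    have hdU : |U.det| = (N : ℤ) ^ m := by
      have h := congrArg abs hdd
      rw [abs_mul, hdet, abs_pow, Nat.abs_cast, pow_succ'] at h
      exact mul_left_cancel₀ hNz h
    have hadj : U.det * C j k = N * U.adjugate j k := by
      have h : C * U * U.adjugate = ((N : ℤ) • (1 : Matrix (Fin (m + 1)) (Fin (m + 1)) ℤ)) * U.adjugate := by
        rw [hCU]
      rw [Matrix.mul_assoc, Matrix.mul_adjugate, Matrix.mul_smul, Matrix.mul_one, Matrix.smul_mul,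
        Matrix.one_mul] at h
      have := congrFun (congrFun h j) k
      simpa [Matrix.smul_apply, mul_comm] using this
    have h1 := abs_adjugate_le U hbox j k
    have h2 : |U.det| * |C j k| ≤ (N : ℤ) * ((m ! : ℤ) * (N : ℤ) ^ m) := by
      rw [← abs_mul, hadj, abs_mul, Nat.abs_cast]
      exact mul_le_mul_of_nonneg_left h1 (by positivity)
    rw [hdU] at h2
    have hNm : (0 : ℤ) < (N : ℤ) ^ m := by positivity
    have h3 : (N : ℤ) ^ m * |C j k| ≤ (N : ℤ) ^ m * ((m ! : ℤ) * N) := by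
      calc (N : ℤ) ^ m * |C j k| ≤ (N : ℤ) * ((m ! : ℤ) * (N : ℤ) ^ m) := h2
        _ = (N : ℤ) ^ m * ((m ! : ℤ) * N) := by ring
    simpa using le_of_mul_le_mul_left h3 hNm

/-! ### The reduced saturation frame of a crux datum -/

/-- **THE REDUCED SATURATION FRAME (sizes included).** For positive multiplicatively independent rationals `α₁,…,αₙ`:
a positive independent `θ`, `q`-saturated up to sign for every `q ≥ 1` (so `2`-Kummer: `∏ θᵢ^{κᵢ} = ±γ² ⇒ 2 ∣ κ`),
integer matrices `U, C` and `0 < N = |det C| ≤ ∏ⱼ 2h(αⱼ)/log 2` with `θᵢ^N = ∏ⱼ αⱼ^{Uᵢⱼ}`, `αⱼ = ∏ᵢ θᵢ^{Cⱼᵢ}`,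
`U·C = N·1 = C·U`, and the SIZE lines of the Hermite-reduced basis of `𝔑`: `0 ≤ Uᵢⱼ ≤ N`, `Σᵢ |Uᵢⱼ| ≤ n·N`,
`|Cⱼₖ| ≤ (n−1)!·N`, `h(θᵢ) ≤ Σⱼ h(αⱼ)`; `p`-adic units stay units.
[cite: Nesterenko2003, §3.4–3.5 and §4.3 Cor 4.5; Cassels1997, Ch. I §2.2] -/
theorem exists_reduced_satFrame (α : Fin n → ℚ) (hα : ∀ j, 0 < α j)
    (hind : ∀ μ : Fin n → ℤ, ∏ j, α j ^ μ j = 1 → μ = 0) :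
    ∃ (θ : Fin n → ℚ) (U C : Matrix (Fin n) (Fin n) ℤ) (N : ℕ),
      (∀ i, 0 < θ i) ∧
      (∀ μ : Fin n → ℤ, ∏ i, θ i ^ μ i = 1 → μ = 0) ∧
      (∀ q : ℕ, 0 < q → ∀ γ : ℚ, (∃ c : Fin n → ℤ, γ ^ q = ∏ i, θ i ^ c i) →
        ∃ c : Fin n → ℤ, γ = ∏ i, θ i ^ c i ∨ -γ = ∏ i, θ i ^ c i) ∧
      (∀ κ : Fin n → ℤ, (∃ γ : ℚ, ∏ i, θ i ^ κ i = γ ^ 2 ∨ ∏ i, θ i ^ κ i = -γ ^ 2) →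
        ∀ i, (2 : ℤ) ∣ κ i) ∧
      0 < N ∧
      (∀ i, θ i ^ N = ∏ j, α j ^ U i j) ∧
      (∀ j, α j = ∏ i, θ i ^ C j i) ∧
      U * C = (N : ℤ) • (1 : Matrix (Fin n) (Fin n) ℤ) ∧
      C * U = (N : ℤ) • (1 : Matrix (Fin n) (Fin n) ℤ) ∧
      (N : ℤ) = |C.det| ∧
      (N : ℝ) ≤ ∏ j, (2 * Height.logHeight₁ (α j) / Real.log 2) ∧
      (∀ i j, 0 ≤ U i j ∧ U i j ≤ N) ∧
      (∀ j, ∑ i, |U i j| ≤ (n : ℤ) * N) ∧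
      (∀ j k, |C j k| ≤ ((n - 1) ! : ℤ) * N) ∧
      (∀ i, Height.logHeight₁ (θ i) ≤ ∑ j, Height.logHeight₁ (α j)) ∧
      (∀ p : ℕ, p.Prime → (∀ j, padicValRat p (α j) = 0) → ∀ i, padicValRat p (θ i) = 0) := by
  classical
  have hα0 : ∀ j, α j ≠ 0 := fun j => (hα j).ne'
  have habs : ∀ j, |α j| = α j := fun j => abs_of_pos (hα j)
  obtain ⟨θ, C, U, N, hpos, hθind, hsat, hC, hNpos, hNdet, hNle, hU, -, -, -⟩ :=
    SatFrameKit.exists_satFrame α hα0 hind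
  simp only [habs] at hC hU
  have hθ0 : ∀ i, θ i ≠ 0 := fun i => (hpos i).ne'
  have hUC : U * C = (N : ℤ) • (1 : Matrix (Fin n) (Fin n) ℤ) := mul_eq_smul_one_of_indep α θ hθ0 hθind C U N hC hU
  have hNz : (N : ℤ) ≠ 0 := by exact_mod_cast hNpos.ne'
  have hCU : C * U = (N : ℤ) • (1 : Matrix (Fin n) (Fin n) ℤ) := mul_eq_smul_one_comm hNz hUC
  obtain ⟨θ', P, Q, hPQ, hQP, hθ'pos, htr1, htr2, hC', hU', hCU', hUC', hbox⟩ :=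
    exists_reduced_frame α θ hα0 hpos C U N hNpos hC hU hCU hUC
  have hθ'0 : ∀ i, θ' i ≠ 0 := fun i => (hθ'pos i).ne'
  -- independence of `θ'`
  have hθ'ind : ∀ μ : Fin n → ℤ, ∏ i, θ' i ^ μ i = 1 → μ = 0 := by
    intro μ hμ
    rw [htr1] at hμ
    have h1 := hθind _ hμ
    have h2 : μ = (μ ᵥ* P) ᵥ* Q := by rw [Matrix.vecMul_vecMul, hPQ, Matrix.vecMul_one]
    rw [h2, h1, Matrix.zero_vecMul]
  -- `q`-saturation of `θ'`
  have hsat' : ∀ q : ℕ, 0 < q → ∀ γ : ℚ, (∃ c : Fin n → ℤ, γ ^ q = ∏ i, θ' i ^ c i) →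
      ∃ c : Fin n → ℤ, γ = ∏ i, θ' i ^ c i ∨ -γ = ∏ i, θ' i ^ c i := by
    rintro q hq γ ⟨c, hc⟩
    rw [htr1] at hc
    obtain ⟨c', hc'⟩ := hsat q hq γ ⟨_, hc⟩
    refine ⟨c' ᵥ* Q, ?_⟩
    rwa [← htr2]
  -- `2`-Kummer
  have hkum : ∀ κ : Fin n → ℤ, (∃ γ : ℚ, ∏ i, θ' i ^ κ i = γ ^ 2 ∨ ∏ i, θ' i ^ κ i = -γ ^ 2) →
      ∀ i, (2 : ℤ) ∣ κ i := by
    rintro κ ⟨γ, hγ⟩ i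
    have hpos' : 0 < ∏ i, θ' i ^ κ i := Finset.prod_pos fun i _ => zpow_pos (hθ'pos i) _
    have hsq : ∏ i, θ' i ^ κ i = γ ^ 2 := by
      rcases hγ with h | h
      · exact h
      · exfalso; have := sq_nonneg γ; linarith
    obtain ⟨c, hc⟩ := hsat' 2 two_pos γ ⟨κ, hsq.symm⟩
    have hγ2 : γ ^ 2 = ∏ i, θ' i ^ (2 * c i) := by
      have h' : γ ^ 2 = (∏ i, θ' i ^ c i) ^ 2 := by
        rcases hc with h | h
        · rw [← h]
        · rw [← h, neg_sq]
      rw [h', ← Finset.prod_pow]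
      refine Finset.prod_congr rfl fun i _ => ?_
      rw [← zpow_natCast, ← _root_.zpow_mul, mul_comm]
      rfl
    have h1 : ∏ i, θ' i ^ (κ i - 2 * c i) = 1 := by
      simp_rw [zpow_sub₀ (hθ'0 _)]
      rw [Finset.prod_div_distrib, ← hγ2, hsq, div_self (by rw [← hsq]; exact hpos'.ne')]
    have h2 := hθ'ind (fun i => κ i - 2 * c i) h1
    have h3 := congrFun h2 i
    simp only [Pi.zero_apply, sub_eq_zero] at h3
    exact ⟨c i, h3⟩
  -- `|det (C·Q)| = N`
  have hdetQ : |Q.det| = 1 := by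
    have h := congrArg Matrix.det hPQ
    rw [Matrix.det_mul, Matrix.det_one, mul_comm] at h
    exact Int.isUnit_iff_abs_eq.mp (IsUnit.of_mul_eq_one _ h)
  have hNdet' : (N : ℤ) = |(C * Q).det| := by rw [Matrix.det_mul, abs_mul, hdetQ, mul_one]; exact hNdet
  -- heights of `θ'`
  have hht : ∀ i, Height.logHeight₁ (θ' i) ≤ ∑ j, Height.logHeight₁ (α j) := by
    intro i
    have h := SatCoords.natCast_mul_logHeight₁_prod_zpow_le α θ' (P * U) N hα0 hU' (Pi.single i 1)
    have hs : ∏ k, θ' k ^ (Pi.single i (1 : ℤ) : Fin n → ℤ) k = θ' i := by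
      rw [Finset.prod_eq_single i (fun k _ hk => by rw [Pi.single_eq_of_ne hk, zpow_zero]) (by simp),
        Pi.single_eq_same, zpow_one]
    have hv : ∀ j, (Pi.single i (1 : ℤ) ᵥ* (P * U)) j = (P * U) i j := fun j => by
      simp [Matrix.vecMul, dotProduct, Pi.single_apply]
    rw [hs] at h
    simp_rw [hv] at h
    have hN' : (0 : ℝ) < N := by exact_mod_cast hNpos
    have h2 : ∑ j, (|(P * U) i j| : ℝ) * Height.logHeight₁ (α j) ≤ ∑ j, (N : ℝ) * Height.logHeight₁ (α j) := by
      refine Finset.sum_le_sum fun j _ => mul_le_mul_of_nonneg_right ?_ (Height.zero_le_logHeight₁ _)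
      rw [abs_of_nonneg (by exact_mod_cast (hbox i j).1)]
      exact_mod_cast (hbox i j).2
    rw [← Finset.mul_sum] at h2
    exact le_of_mul_le_mul_left (h.trans h2) hN'
  refine ⟨θ', P * U, C * Q, N, hθ'pos, hθ'ind, hsat', hkum, hNpos, hU', hC', hUC', hCU', hNdet', hNle, hbox,
    fun j => sum_abs_le_of_box hbox j,
    fun j k => abs_le_of_mul_eq_smul_one hNpos (C * Q) (P * U) hCU' hNdet'.symm hbox j k, hht, ?_⟩
  -- `p`-adic units stay units
  intro p hp hunit i
  haveI : Fact p.Prime := ⟨hp⟩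
  have h1 : padicValRat p (θ' i ^ N) = 0 := by
    rw [hU' i]; exact SatFrameKit.padicValRat_prod_zpow_eq_zero _ hα0 hunit _
  exact SatFrameKit.padicValRat_eq_zero_of_pow hNpos.ne' h1

/-- The weaker size lines in the currency of p2's `SatKit` (`max(1, h)` weights, `n!`):
`N ≤ ∏ⱼ 2·max(1,h(αⱼ))/log 2`, `|Cⱼₖ| ≤ n!·N`, `h(θᵢ) ≤ Σⱼ max(1, h(αⱼ))`. [folklore] -/
theorem sizes_weaken {α θ : Fin n → ℚ} {C : Matrix (Fin n) (Fin n) ℤ} {N : ℕ}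
    (hNle : (N : ℝ) ≤ ∏ j, (2 * Height.logHeight₁ (α j) / Real.log 2))
    (hCle : ∀ j k, |C j k| ≤ ((n - 1) ! : ℤ) * N)
    (hht : ∀ i, Height.logHeight₁ (θ i) ≤ ∑ j, Height.logHeight₁ (α j)) :
    (N : ℝ) ≤ ∏ j, (2 * max 1 (Height.logHeight₁ (α j)) / Real.log 2) ∧
    (∀ j k, |C j k| ≤ (n ! : ℤ) * N) ∧
    (∀ i, Height.logHeight₁ (θ i) ≤ ∑ j, max 1 (Height.logHeight₁ (α j))) := by
  have hl : 0 < Real.log 2 := Real.log_pos one_lt_two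
  refine ⟨hNle.trans (Finset.prod_le_prod (fun j _ => by
      have := Height.zero_le_logHeight₁ (α j); positivity) fun j _ => ?_), fun j k => (hCle j k).trans ?_,
    fun i => (hht i).trans (Finset.sum_le_sum fun j _ => le_max_right _ _)⟩
  · exact div_le_div_of_nonneg_right (by linarith [le_max_right 1 (Height.logHeight₁ (α j))]) hl.le
  · refine mul_le_mul_of_nonneg_right ?_ (by positivity)
    exact_mod_cast Nat.factorial_le (Nat.sub_le n 1)

end SatBasisReduced

end Summit.ABC.StewartYu
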